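import Mathlib
import HarnessLib
import Literature.Probability.Percolation.QuadCrossingSquareModel
import Literature.Barriers.CriticalPhenomena.EmbeddingModulusUniquenessProofs
import Literature.Probability.RandomPlanarGeometry.ConformalRectangleProofs
import Literature.Probability.RandomPlanarGeometry.ChordalCurveFamily
import Literature.Probability.RandomPlanarGeometry.DiamondShearChart

/-!
# Crux `SegmentOpen` (stmt-CriticalPhenomena-5471), line `Sketch` — stub `stub_shearCapacity_eq`

The set of Dirichlet energies of the admissible test functions of Beffara's sheared quad
`φ_α R'` equals the set of `α`-anisotropic energies
`∫_{R'} im α (∂ₓV)² + (∂_yV − re α ∂ₓV)² / im α` of the admissible test functions `V` of `R'`.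
This is the linear change of variables `V = U ∘ φ_α`: the shear `φ_α = moduliShear α`
(`x + iy ↦ x + y re α + i y im α`) is an `ℝ`-linear automorphism of `ℂ` with matrix
`[[1, re α], [0, im α]]` and Jacobian `im α`, and `ℂ` is Euclidean in the coordinates `(re, im)`,
so that `im α · ‖∇U (φ_α z)‖² = im α (∂ₓV z)² + (∂_yV z − re α ∂ₓV z)² / im α`.
-/

noncomputable section

namespace Summit.CriticalPhenomena.CardyFormulaZ2.Theorems

open Literature.Probability Literature.Barriers.CriticalPhenomena
open Literature.Probability.RandomPlanarGeometry (ConformalRectangle ConformalEquiv MarkedDomain)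
open Filter Set Topology MeasureTheory
open UpperHalfPlane (upperHalfPlaneSet)

/-- The shear `φ_α` (`im α ≠ 0`) is an `ℝ`-linear automorphism of `ℂ` with determinant `im α`
(matrix `[[1, re α], [0, im α]]` in the basis `(1, i)`). -/
private theorem exists_shearCLE (α : ℂ) (hα : α.im ≠ 0) :
    ∃ L : ℂ ≃L[ℝ] ℂ, ⇑L = moduliShear α ∧ (L : ℂ →L[ℝ] ℂ).det = α.im := by
  let L : ℂ ≃L[ℝ] ℂ :=
    { toFun := moduliShear α
      invFun := moduliShear ((Complex.I - (α.re : ℂ)) / (α.im : ℂ))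
      map_add' := fun z w => by
        apply Complex.ext <;> simp [moduliShear] <;> ring
      map_smul' := fun c z => by
        apply Complex.ext <;> simp [moduliShear] <;> ring
      left_inv := (shearHomeomorph α hα).left_inv
      right_inv := (shearHomeomorph α hα).right_inv
      continuous_toFun := continuous_moduliShear α
      continuous_invFun := continuous_moduliShear _ }
  have hL : ⇑L = moduliShear α := rfl
  refine ⟨L, hL, ?_⟩
  change LinearMap.det ((L : ℂ →L[ℝ] ℂ) : ℂ →ₗ[ℝ] ℂ) = α.im
  rw [← LinearMap.det_toMatrix Complex.basisOneI, Matrix.det_fin_two]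
  simp [LinearMap.toMatrix_apply, hL]

/-- `ℂ` is Euclidean in the coordinates `(re, im)`: the operator norm of a real-linear functional
`ℓ` on `ℂ` satisfies `‖ℓ‖² = ℓ(1)² + ℓ(i)²`. -/
private theorem opNorm_sq_eq (ℓ : ℂ →L[ℝ] ℝ) :
    ‖ℓ‖ ^ 2 = (ℓ 1) ^ 2 + (ℓ Complex.I) ^ 2 := by
  obtain ⟨v, rfl⟩ := (InnerProductSpace.toDual ℝ ℂ).surjective ℓ
  rw [LinearIsometryEquiv.norm_map, InnerProductSpace.toDual_apply_apply,
    InnerProductSpace.toDual_apply_apply, Complex.inner, Complex.inner, Complex.sq_norm,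
    Complex.normSq_apply]
  simp
  ring

/-- Chain rule for `U ∘ L` at a point of the open set `S`, `U` being `C¹` on `L '' S`. -/
private theorem fderiv_comp_cle (L : ℂ ≃L[ℝ] ℂ) {S : Set ℂ} (hS : IsOpen S) {U : ℂ → ℝ}
    (hU : ContDiffOn ℝ 1 U (L '' S)) {z : ℂ} (hz : z ∈ S) :
    fderiv ℝ (U ∘ L) z = (fderiv ℝ U (L z)).comp (L : ℂ →L[ℝ] ℂ) := by
  have hopen : IsOpen (L '' S) := L.isOpenMap S hS
  have hd : DifferentiableAt ℝ U (L z) :=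
    hU.differentiableOn_one.differentiableAt (hopen.mem_nhds (mem_image_of_mem L hz))
  rw [fderiv_comp z hd L.differentiableAt, L.fderiv]

/-- The `α`-anisotropic integrand of `V = U ∘ φ_α` at `z` is `im α · ‖∇U (φ_α z)‖²`
(`ℓ = fderiv ℝ U (φ_α z)`, `fderiv ℝ V z = ℓ ∘L φ_α`, `φ_α 1 = 1`, `φ_α i = α`). -/
private theorem integrand_eq {α : ℂ} (hα : α.im ≠ 0) (L : ℂ ≃L[ℝ] ℂ) (hL : ⇑L = moduliShear α)
    (ℓ : ℂ →L[ℝ] ℝ) :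
    α.im * (ℓ.comp (L : ℂ →L[ℝ] ℂ) 1) ^ 2 +
        (ℓ.comp (L : ℂ →L[ℝ] ℂ) Complex.I - α.re * ℓ.comp (L : ℂ →L[ℝ] ℂ) 1) ^ 2 / α.im =
      α.im * ‖ℓ‖ ^ 2 := by
  have hℓα : ℓ α = α.re * ℓ 1 + α.im * ℓ Complex.I := by
    conv_lhs => rw [← Complex.re_add_im α]
    rw [map_add, show ((α.re : ℂ)) = α.re • (1 : ℂ) by rw [Complex.real_smul, mul_one],
      show (α.im : ℂ) * Complex.I = α.im • Complex.I from Complex.real_smul.symm,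
      map_smul, map_smul, smul_eq_mul, smul_eq_mul]
  simp only [ContinuousLinearMap.comp_apply, ContinuousLinearEquiv.coe_coe, hL, moduliShear_one,
    moduliShear_I, hℓα, opNorm_sq_eq ℓ]
  field_simp
  ring

/-- Change of variables `w = φ_α z` in the Dirichlet energy: for `U` of class `C¹` on `φ_α '' S`
(`S` open), `∫_{φ_α S} ‖∇U‖² = ∫_S im α (∂ₓV)² + (∂_yV − re α ∂ₓV)² / im α`, `V = U ∘ φ_α`. -/
private theorem energy_eq {α : ℂ} (hα : 0 < α.im) (L : ℂ ≃L[ℝ] ℂ) (hL : ⇑L = moduliShear α)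
    (hdet : (L : ℂ →L[ℝ] ℂ).det = α.im) {S : Set ℂ} (hS : IsOpen S) {U : ℂ → ℝ}
    (hU : ContDiffOn ℝ 1 U (L '' S)) :
    ∫ w in L '' S, ‖fderiv ℝ U w‖ ^ 2 =
      ∫ z in S, (α.im * (fderiv ℝ (U ∘ L) z 1) ^ 2 +
        (fderiv ℝ (U ∘ L) z Complex.I - α.re * fderiv ℝ (U ∘ L) z 1) ^ 2 / α.im) := by
  rw [integral_image_eq_integral_abs_det_fderiv_smul volume hS.measurableSet
    (fun x _ => L.hasFDerivWithinAt) L.injective.injOn]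
  refine setIntegral_congr_fun hS.measurableSet fun z hz => ?_
  simp only [hdet, abs_of_pos hα, smul_eq_mul]
  rw [fderiv_comp_cle L hS hU hz, integrand_eq hα.ne' L hL]

/-- Square-integrability of the gradient transfers along the linear change of variables
`V = U ∘ φ_α` (two-sided comparison `‖∇V z‖ ≤ ‖φ_α‖ ‖∇U (φ_α z)‖`,
`‖∇U (φ_α z)‖ ≤ ‖φ_α⁻¹‖ ‖∇V z‖`, plus the change of variables with constant Jacobian `im α`). -/
private theorem integrableOn_comp_iff {α : ℂ} (hα : 0 < α.im) (L : ℂ ≃L[ℝ] ℂ)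
    (hdet : (L : ℂ →L[ℝ] ℂ).det = α.im) {S : Set ℂ} (hS : IsOpen S) {U : ℂ → ℝ}
    (hU : ContDiffOn ℝ 1 U (L '' S)) :
    IntegrableOn (fun w => ‖fderiv ℝ U w‖ ^ 2) (L '' S) ↔
      IntegrableOn (fun z => ‖fderiv ℝ (U ∘ L) z‖ ^ 2) S := by
  rw [integrableOn_image_iff_integrableOn_abs_det_fderiv_smul volume hS.measurableSet
    (fun x _ => L.hasFDerivWithinAt) L.injective.injOn]
  simp only [hdet, abs_of_pos hα, smul_eq_mul]
  have hmeas₁ : AEStronglyMeasurable (fun z => ‖fderiv ℝ (U ∘ L) z‖ ^ 2) (volume.restrict S) :=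
    ((measurable_fderiv ℝ (U ∘ L)).norm.pow_const 2).aestronglyMeasurable
  have hmeas₂ : AEStronglyMeasurable (fun z => α.im * ‖fderiv ℝ U (L z)‖ ^ 2)
      (volume.restrict S) :=
    ((((measurable_fderiv ℝ U).comp L.continuous.measurable).norm.pow_const 2).const_mul
      α.im).aestronglyMeasurable
  have key : ∀ z ∈ S, fderiv ℝ (U ∘ L) z = (fderiv ℝ U (L z)).comp (L : ℂ →L[ℝ] ℂ) :=
    fun z hz => fderiv_comp_cle L hS hU hz
  have key' : ∀ z ∈ S, fderiv ℝ U (L z) = (fderiv ℝ (U ∘ L) z).comp (L.symm : ℂ →L[ℝ] ℂ) :=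
    fun z hz => by
      rw [key z hz, ContinuousLinearMap.comp_assoc, ContinuousLinearEquiv.coe_comp_coe_symm,
        ContinuousLinearMap.comp_id]
  constructor
  · intro h
    refine Integrable.mono' (h.integrable.const_mul (‖(L : ℂ →L[ℝ] ℂ)‖ ^ 2 / α.im)) hmeas₁ ?_
    filter_upwards [ae_restrict_mem hS.measurableSet] with z hz
    rw [Real.norm_of_nonneg (sq_nonneg _), key z hz]
    calc ‖(fderiv ℝ U (L z)).comp (L : ℂ →L[ℝ] ℂ)‖ ^ 2
        ≤ (‖fderiv ℝ U (L z)‖ * ‖(L : ℂ →L[ℝ] ℂ)‖) ^ 2 := by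
          gcongr
          exact ContinuousLinearMap.opNorm_comp_le _ _
      _ = ‖(L : ℂ →L[ℝ] ℂ)‖ ^ 2 / α.im * (α.im * ‖fderiv ℝ U (L z)‖ ^ 2) := by
          field_simp
  · intro h
    refine Integrable.mono' (h.integrable.const_mul (α.im * ‖(L.symm : ℂ →L[ℝ] ℂ)‖ ^ 2)) hmeas₂ ?_
    filter_upwards [ae_restrict_mem hS.measurableSet] with z hz
    rw [Real.norm_of_nonneg (by positivity), key' z hz]
    calc α.im * ‖(fderiv ℝ (U ∘ L) z).comp (L.symm : ℂ →L[ℝ] ℂ)‖ ^ 2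
        ≤ α.im * (‖fderiv ℝ (U ∘ L) z‖ * ‖(L.symm : ℂ →L[ℝ] ℂ)‖) ^ 2 := by
          gcongr
          exact ContinuousLinearMap.opNorm_comp_le _ _
      _ = α.im * ‖(L.symm : ℂ →L[ℝ] ℂ)‖ ^ 2 * ‖fderiv ℝ (U ∘ L) z‖ ^ 2 := by ring

/-- `C¹`-regularity transfers along the linear change of variables `V = U ∘ L`. -/
private theorem contDiffOn_comp_iff (L : ℂ ≃L[ℝ] ℂ) {S : Set ℂ} {U : ℂ → ℝ} :
    ContDiffOn ℝ 1 U (L '' S) ↔ ContDiffOn ℝ 1 (U ∘ L) S := by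
  constructor
  · intro h
    exact (h.comp_continuousLinearMap (L : ℂ →L[ℝ] ℂ)).mono (subset_preimage_image _ _)
  · intro h
    rw [L.image_eq_preimage_symm]
    have h' := h.comp_continuousLinearMap (L.symm : ℂ →L[ℝ] ℂ)
    have hfun : (U ∘ ⇑L) ∘ ⇑(L.symm : ℂ →L[ℝ] ℂ) = U := by
      funext w
      simp
    rwa [hfun] at h'

/-- Boundary conditions near an arc transfer along the linear change of variables `V = U ∘ L`
(`O ↦ L ⁻¹' O`, `O ↦ L '' O`). -/
private theorem bc_comp_iff (L : ℂ ≃L[ℝ] ℂ) {S A : Set ℂ} {U : ℂ → ℝ} {c : ℝ} :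
    (∃ O : Set ℂ, IsOpen O ∧ L '' A ⊆ O ∧ ∀ z ∈ O ∩ L '' S, U z = c) ↔
      ∃ O : Set ℂ, IsOpen O ∧ A ⊆ O ∧ ∀ z ∈ O ∩ S, (U ∘ L) z = c := by
  constructor
  · rintro ⟨O, hO, hAO, hU⟩
    exact ⟨L ⁻¹' O, hO.preimage L.continuous, image_subset_iff.1 hAO,
      fun z hz => hU (L z) ⟨hz.1, mem_image_of_mem L hz.2⟩⟩
  · rintro ⟨O, hO, hAO, hU⟩
    refine ⟨L '' O, L.isOpenMap O hO, image_mono hAO, ?_⟩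
    rintro w ⟨⟨o, ho, rfl⟩, ⟨z, hz, hzo⟩⟩
    obtain rfl := L.injective hzo
    exact hU z ⟨ho, hz⟩

/-- **Stub `SH` of line `Sketch`.** The set of Dirichlet energies of the admissible test
functions of the sheared quad `φ_α R'` (`φ_α = moduliShear α`, `im α > 0`) equals the set of
`α`-anisotropic energies `∫_{R'} im α (∂ₓV)² + (∂_yV − re α ∂ₓV)² / im α` of the admissible test
functions `V` of `R'`: the linear change of variables `V = U ∘ φ_α` (Jacobian `im α`,
`∇U (φ_α z) = (∂ₓV z, (∂_yV z − re α ∂ₓV z) / im α)`), transporting `C¹`-regularity,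
square-integrability of the gradient and the boundary conditions near the arcs both ways. -/
theorem stub_shearCapacity_eq :
    ∀ (R' : ConformalRectangle) (α : ℂ) (hα : 0 < α.im),
      {e : ℝ | ∃ U : ℂ → ℝ,
          (ContDiffOn ℝ 1 U (R'.map (shearHomeomorph α hα.ne')).carrier ∧
            IntegrableOn (fun z => ‖fderiv ℝ U z‖ ^ 2) (R'.map (shearHomeomorph α hα.ne')).carrier ∧
            (∃ O : Set ℂ, IsOpen O ∧ (R'.map (shearHomeomorph α hα.ne')).arc 0 ⊆ O ∧
              ∀ z ∈ O ∩ (R'.map (shearHomeomorph α hα.ne')).carrier, U z = 0) ∧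
            (∃ O : Set ℂ, IsOpen O ∧ (R'.map (shearHomeomorph α hα.ne')).arc 2 ⊆ O ∧
              ∀ z ∈ O ∩ (R'.map (shearHomeomorph α hα.ne')).carrier, U z = 1)) ∧
          e = ∫ z in (R'.map (shearHomeomorph α hα.ne')).carrier, ‖fderiv ℝ U z‖ ^ 2} =
      {e : ℝ | ∃ U : ℂ → ℝ,
          (ContDiffOn ℝ 1 U R'.carrier ∧
            IntegrableOn (fun z => ‖fderiv ℝ U z‖ ^ 2) R'.carrier ∧
            (∃ O : Set ℂ, IsOpen O ∧ R'.arc 0 ⊆ O ∧ ∀ z ∈ O ∩ R'.carrier, U z = 0) ∧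
            (∃ O : Set ℂ, IsOpen O ∧ R'.arc 2 ⊆ O ∧ ∀ z ∈ O ∩ R'.carrier, U z = 1)) ∧
          e = ∫ z in R'.carrier, (α.im * (fderiv ℝ U z 1) ^ 2 +
            (fderiv ℝ U z Complex.I - α.re * fderiv ℝ U z 1) ^ 2 / α.im)} := by
  intro R' α hα
  obtain ⟨L, hL, hdet⟩ := exists_shearCLE α hα.ne'
  simp only [MarkedDomain.carrier_map, MarkedDomain.arc_map, coe_shearHomeomorph]
  rw [← hL]
  ext e
  constructor
  · rintro ⟨U, ⟨hC, hI, h0, h2⟩, rfl⟩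
    exact ⟨U ∘ L, ⟨(contDiffOn_comp_iff L).1 hC, (integrableOn_comp_iff hα L hdet R'.isOpen hC).1 hI,
      (bc_comp_iff L).1 h0, (bc_comp_iff L).1 h2⟩, energy_eq hα L hL hdet R'.isOpen hC⟩
  · rintro ⟨V, ⟨hC, hI, h0, h2⟩, rfl⟩
    have hUV : (V ∘ ⇑L.symm) ∘ ⇑L = V := by
      funext z
      simp
    have hC' : ContDiffOn ℝ 1 (V ∘ ⇑L.symm) (L '' R'.carrier) := by
      rw [contDiffOn_comp_iff L, hUV]
      exact hC
    refine ⟨V ∘ L.symm, ⟨hC', ?_, ?_, ?_⟩, ?_⟩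
    · rw [integrableOn_comp_iff hα L hdet R'.isOpen hC', hUV]
      exact hI
    · rw [bc_comp_iff L, hUV]
      exact h0
    · rw [bc_comp_iff L, hUV]
      exact h2
    · rw [energy_eq hα L hL hdet R'.isOpen hC', hUV]

end Summit.CriticalPhenomena.CardyFormulaZ2.Theorems
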